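import Literature.AlgebraicGeometry.Frobenioids.Thm62Sub
import Literature.AlgebraicGeometry.Frobenioids.GeometricFrobenioidThm62iFunctor
import Literature.FieldTheory.Regular.SeparablyClosedIrreducible
import HarnessLib

/-!
# [FrdI] Thm. 6.2 (i) sub-DAG (W5): nodes T62i/L04 and T62i/L02 — DISCHARGED (bindings)

Mochizuki, *The geometry of Frobenioids I* (2008), Theorem 6.2 (i), kurims pp. 110–111
[cite: MochizukiFrdI2008, Thm. 6.2 (i) p.110]. The two named statements of `Thm62Sub.lean` (abc-iut-L1-t3, W5
statements file) are closed by one-line bindings: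
* `Thm62i_of_pullbackDatum` (node T62i/L04) — abc-iut-L1-t3's schema `Thm62i` at THE constructed model
  Frobenioids `geomModelFrobenioid Γ_i` for EVERY pull-back datum over every base functor — is exactly the
  ∀-closure of `GeometricDivisorData.PullbackDatum.thm62i_of_pullbackDatum` (abc-iut-w5-d048,
  `GeometricFrobenioidThm62iFunctor.lean`); binding typed by abc-iut-L1-t3 (staged `Thm62SubHolds.lean`), filed by
  abc-iut-w5-d048 as holder-of-record per the W5 handover;
* `T62i_L02_compositumDegree` (row T62i/L02, step (α) of the printed proof, p. 111 l. 26–29: "`L₂ := L₁ · K₂` …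
  `[L₂ : K₂] = [L₁ : K₁]`") is exactly the classical field-theoretic theorem
  `Literature.FieldTheory.Regular.finrank_adjoin_eq_of_isSepClosedIn` (abc-iut-w5-d048,
  `SeparablyClosedIrreducible.lean`: over a base separably closed in `K₂` the minimal polynomial of a primitive
  element stays irreducible, so the compositum has the same degree).
Proof-only; nothing here bears on [IUTchIII] or takes a side on abc.
-/

namespace Literature.AlgebraicGeometry.Frobenioids

/-- **T62i/L04 DISCHARGED**: Thm. 6.2 (i) at THE models for every pull-back datum (binding typed by
abc-iut-L1-t3). [cite: MochizukiFrdI2008, Thm. 6.2 (i) p.110] -/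
theorem Thm62i_of_pullbackDatum_holds : Thm62i_of_pullbackDatum :=
  fun _ _ _ _ _ _ _ _ _ _ _ _ _ _ h => GeometricDivisorData.PullbackDatum.thm62i_of_pullbackDatum h

/-- **T62i/L02 DISCHARGED**: `[K₂(L₁) : K₂] = [L₁ : K₁]` for `L₁/K₁` finite separable and `K₁` separably closed
in `K₂`. [cite: MochizukiFrdI2008, Thm. 6.2 (i) p.111] -/
theorem T62i_L02_compositumDegree_holds : T62i_L02_compositumDegree :=
  fun _K₁ _K₂ _Ω _ _ _ _ _ _ _ L₁ _ _ hsc =>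
    Literature.FieldTheory.Regular.finrank_adjoin_eq_of_isSepClosedIn hsc L₁

end Literature.AlgebraicGeometry.Frobenioids
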